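import Literature.NumberTheory.LFunctions.LerchFormula
import Literature.NumberTheory.IwasawaTheory.CyclotomicUnitRegulator
import Mathlib.Analysis.SpecialFunctions.Gamma.Beta
import HarnessLib

/-!
# `L'(0, χ)` for an EVEN Dirichlet character: the cyclotomic-unit (log-sine) closed form
# `L'(0, χ) = −½ Σ_{a mod N} χ(a) log|1 − ζ_N^a|`

Topic `Literature/NumberTheory/LFunctions`. Proofs only (no definitions, no named facts).

For an even Dirichlet character `χ ≠ 1` modulo `N` (any level, primitive or not) Mathlib's analytically continued
`χ.LFunction` satisfies `L(0, χ) = 0` and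

  `L'(0, χ) = −½ Σ_{a ∈ (ℤ/N)ˣ} χ(a) log|1 − e^{2πia/N}|`   (`deriv_LFunction_zero_eq_neg_half_cyclotomicLogSum`),

the `s = 0` companion of Lang's Theorem 2.2 (`L(1, χ̄) = −(S(χ̄)/N) Σ χ(a) log|1 − ζ^a|`, tree:
`CyclotomicUnits.lang_thm22_LFunction_one_of_even_holds`) — equivalently the rank-one abelian Stark identity over `ℚ`
(`ζ'_N(0, a) + ζ'_N(0, −a) = −log|1 − ζ_N^a|²/2 …`).  In the currency of
`Literature/NumberTheory/IwasawaTheory/CyclotomicUnitRegulator.lean` the right-hand side is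
`−½ · CyclotomicUnits.cyclotomicLogSum χ`.

## Proof (no functional equation needed)

Lerch's formula, PROVED in the tree (`Lerch.deriv_LFunction_zero_of_ne_one`):
`L'(0, χ) = −(log N)·L(0, χ) + Σ_{a=0}^{N−1} χ(a) log Γ(a/N)`; `L(0, χ) = −χ(0)/2 = 0` (Mathlib
`ZMod.LFunction_apply_zero_of_even`, `χ(0) = 0` as `N ≠ 1`); pairing `a ↔ N − a` (`χ` even) and Euler's reflection
formula `Γ(x)Γ(1 − x) = π / sin(πx)` (Mathlib `Real.Gamma_mul_Gamma_one_sub`) give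
`2 Σ χ(a) log Γ(a/N) = Σ χ(a) (log π − log sin(πa/N)) = −Σ χ(a) log sin(πa/N)` (`Σ χ = 0`); finally
`|1 − ζ_N^a| = 2 sin(πa/N)` for `0 < a < N` and `Σ χ = 0` again absorb the `log 2`.

Use (cell bsd-cm, crux `EllipticUnitValueSevenOfGZK`, input (5) of K1ᵘ): this is the typing debt «(P3)(i) at `s = 0`» of the
print column of the unit-side identity (seat bsd-cm-k-ty1 g25, (S5) note / pen D930).  HONEST LABEL: a textbook identity made a
kernel theorem; nothing here concerns BSD.

## References
S. Lang, *Cyclotomic Fields I and II*, GTM 121 (1990), Ch. 3 §2 Thm. 2.2 (PDF pp. 63–64) [Lang1990];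
L. Washington, *Introduction to Cyclotomic Fields*, 2nd ed. (1997), Thm. 4.9 and §8.1 [Washington1997];
M. Lerch (1894) / the tree's `LerchFormula.lean` [folklore].
-/

noncomputable section

open Complex Finset
open Literature.NumberTheory.IwasawaTheory
open Literature.NumberTheory.IwasawaTheory.CyclotomicUnits (cyclotomicLogSum rootOfUnityPow
  sum_units_eq_sum_mul rootOfUnityPow_eq_cexp_pow)

namespace Literature.NumberTheory.LFunctions

namespace DirichletLEvenAtZero

variable {N : ℕ} [NeZero N]

/-! ### `L(0, χ) = 0` for even `χ ≠ 1` -/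

/-- The level of a non-trivial character is not `1`. [folklore] -/
private theorem level_ne_one {χ : DirichletCharacter ℂ N} (h1 : χ ≠ 1) : N ≠ 1 := by
  rintro rfl
  exact h1 (χ.level_one' rfl)

/-- **`L(0, χ) = 0`** for an even Dirichlet character `χ ≠ 1` (Mathlib: `L(0, Φ) = −Φ(0)/2` for even `Φ`, and
`χ(0) = 0`); Washington's `L(1 − n, χ) = −B_{n,χ}/n` at `n = 1` with `B_{1,χ} = 0` for even `χ ≠ 1`.
[cite: Washington1997, Thm. 4.2] -/
theorem LFunction_zero_eq_zero {χ : DirichletCharacter ℂ N} (heven : χ.Even) (h1 : χ ≠ 1) :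
    χ.LFunction 0 = 0 := by
  rw [DirichletCharacter.LFunction, ZMod.LFunction_apply_zero_of_even heven.to_fun,
    χ.map_zero' (level_ne_one h1), neg_zero, zero_div]

/-! ### Reflection: `log Γ(a/N) + log Γ(1 − a/N) = log π − log sin(πa/N)` -/

/-- Euler's reflection formula in logarithmic form on `(0, 1)`. [folklore] -/
private theorem log_Gamma_add_log_Gamma_one_sub {x : ℝ} (h0 : 0 < x) (h1 : x < 1) :
    Real.log (Real.Gamma x) + Real.log (Real.Gamma (1 - x)) =
      Real.log Real.pi - Real.log (Real.sin (Real.pi * x)) := by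
  have hG1 : 0 < Real.Gamma x := Real.Gamma_pos_of_pos h0
  have hG2 : 0 < Real.Gamma (1 - x) := Real.Gamma_pos_of_pos (by linarith)
  have hsin : 0 < Real.sin (Real.pi * x) :=
    Real.sin_pos_of_pos_of_lt_pi (by positivity) (by nlinarith [Real.pi_pos])
  rw [← Real.log_mul hG1.ne' hG2.ne', Real.Gamma_mul_Gamma_one_sub, Real.log_div Real.pi_pos.ne' hsin.ne']

/-- For `k ≠ 0` in `ℤ/N`: `val(−k) / N = 1 − val(k) / N`. [folklore] -/
private theorem val_neg_div_eq {k : ZMod N} (hk : k ≠ 0) :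
    ((-k).val : ℝ) / N = 1 - (k.val : ℝ) / N := by
  have hN : (0 : ℝ) < N := by exact_mod_cast NeZero.pos N
  rw [ZMod.neg_val, if_neg hk, Nat.cast_sub (ZMod.val_lt k).le]
  field_simp

/-- The paired log-Gamma term: for `k ≠ 0`,
`log Γ(val k / N) + log Γ(val(−k) / N) = log π − log sin(π·val k / N)`. [folklore] -/
private theorem log_Gamma_pair {k : ZMod N} (hk : k ≠ 0) :
    Real.log (Real.Gamma ((k.val : ℝ) / N)) + Real.log (Real.Gamma (((-k).val : ℝ) / N)) =
      Real.log Real.pi - Real.log (Real.sin (Real.pi * k.val / N)) := by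
  have hN : (0 : ℝ) < N := by exact_mod_cast NeZero.pos N
  have hk0 : 0 < (k.val : ℝ) := by exact_mod_cast Nat.pos_of_ne_zero ((ZMod.val_ne_zero k).mpr hk)
  have hlt : (k.val : ℝ) < N := by exact_mod_cast ZMod.val_lt k
  rw [val_neg_div_eq hk, log_Gamma_add_log_Gamma_one_sub (div_pos hk0 hN) ((div_lt_one hN).mpr hlt),
    mul_div_assoc]

/-! ### The log-Gamma sum of an even character -/

section Sums

variable (χ : DirichletCharacter ℂ N)

/-- Re-indexing the `Finset.range N` sum of Lerch's formula by `ℤ/N`. [folklore] -/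
private theorem sum_range_eq_sum_zmod (g : ZMod N → ℂ) :
    ∑ a ∈ Finset.range N, g (a : ZMod N) = ∑ k : ZMod N, g k := by
  refine Finset.sum_nbij' (fun a => (a : ZMod N)) (fun k => k.val) (fun a _ => Finset.mem_univ _)
    (fun k _ => Finset.mem_range.mpr (ZMod.val_lt k)) (fun a ha => ?_) (fun k _ => ?_) (fun a _ => rfl)
  · exact ZMod.val_natCast_of_lt (Finset.mem_range.mp ha)
  · exact ZMod.natCast_zmod_val k

/-- Lerch's sum re-indexed: `Σ_{a<N} χ(a) log Γ(a/N) = Σ_{k ∈ ℤ/N} χ(k) log Γ(val k / N)`. [folklore] -/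
private theorem sum_range_log_Gamma_eq :
    ∑ a ∈ Finset.range N, χ a * (Real.log (Real.Gamma (a / N)) : ℂ) =
      ∑ k : ZMod N, χ k * (Real.log (Real.Gamma ((k.val : ℝ) / N)) : ℂ) := by
  rw [← sum_range_eq_sum_zmod (fun k : ZMod N => χ k * (Real.log (Real.Gamma ((k.val : ℝ) / N)) : ℂ))]
  refine Finset.sum_congr rfl fun a ha => ?_
  rw [ZMod.val_natCast_of_lt (Finset.mem_range.mp ha)]

variable {χ}

/-- **The reflected log-Gamma sum**: for `χ` even and `≠ 1`,
`Σ_k χ(k) log Γ(val k / N) = −½ Σ_k χ(k) log sin(π·val k / N)`. [folklore] -/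
private theorem sum_log_Gamma_eq_neg_half_sum_log_sin (heven : χ.Even) (h1 : χ ≠ 1) :
    ∑ k : ZMod N, χ k * (Real.log (Real.Gamma ((k.val : ℝ) / N)) : ℂ) =
      -(1 / 2) * ∑ k : ZMod N, χ k * (Real.log (Real.sin (Real.pi * k.val / N)) : ℂ) := by
  set ℓ : ZMod N → ℂ := fun k => (Real.log (Real.Gamma ((k.val : ℝ) / N)) : ℂ) with hℓ
  have hsum : ∑ k : ZMod N, χ k = 0 := MulChar.sum_eq_zero_of_ne_one h1
  have h0 : χ 0 = 0 := χ.map_zero' (level_ne_one h1)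
  -- re-index by `k ↦ −k` and use evenness
  have hA : ∑ k : ZMod N, χ k * ℓ k = ∑ k : ZMod N, χ k * ℓ (-k) := by
    rw [← Fintype.sum_equiv (Equiv.neg (ZMod N)) (fun k => χ k * ℓ (-k)) (fun k => χ k * ℓ k)
      fun k => by simp only [Equiv.neg_apply, heven.eval_neg]]
  -- pair the two copies
  have h2 : ∑ k : ZMod N, χ k * ℓ (-k) + ∑ k : ZMod N, χ k * ℓ k =
      ∑ k : ZMod N, χ k * ((Real.log Real.pi : ℂ) - (Real.log (Real.sin (Real.pi * k.val / N)) : ℂ)) := by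
    rw [← Finset.sum_add_distrib]
    refine Finset.sum_congr rfl fun k _ => ?_
    by_cases hk : k = 0
    · rw [hk, h0]; ring
    · rw [← mul_add, hℓ]
      simp only
      rw [← Complex.ofReal_add, add_comm, log_Gamma_pair hk, Complex.ofReal_sub]
  rw [← hA, ← two_mul] at h2
  have h3 : ∑ k : ZMod N, χ k * ((Real.log Real.pi : ℂ) - (Real.log (Real.sin (Real.pi * k.val / N)) : ℂ)) =
      -∑ k : ZMod N, χ k * (Real.log (Real.sin (Real.pi * k.val / N)) : ℂ) := by
    simp only [mul_sub, Finset.sum_sub_distrib, ← Finset.sum_mul, hsum, zero_mul, zero_sub]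
  rw [h3] at h2
  linear_combination h2 / 2

/-- `|1 − ζ_N^m| = 2 sin(πm/N)` for `0 ≤ m ≤ N` (`ζ_N = e^{2πi/N}`). [folklore] -/
private theorem norm_one_sub_cexp_pow {m : ℕ} (hm : m ≤ N) :
    ‖1 - cexp (2 * Real.pi * I / N) ^ m‖ = 2 * Real.sin (Real.pi * m / N) := by
  have hN : (0 : ℝ) < N := by exact_mod_cast NeZero.pos N
  rw [norm_sub_rev, ← Complex.exp_nat_mul,
    show (m : ℂ) * (2 * Real.pi * I / N) = I * ((2 * Real.pi * m / N : ℝ) : ℂ) by push_cast; ring,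
    Complex.norm_exp_I_mul_ofReal_sub_one, show 2 * Real.pi * m / N / 2 = Real.pi * m / N by ring,
    Real.norm_eq_abs, abs_of_nonneg]
  refine mul_nonneg zero_le_two (Real.sin_nonneg_of_nonneg_of_le_pi (by positivity) ?_)
  rw [div_le_iff₀ hN]
  have : (m : ℝ) ≤ N := by exact_mod_cast hm
  nlinarith [Real.pi_pos]

/-- **The cyclotomic log sum in log-sine form**: for `χ ≠ 1`,
`cyclotomicLogSum χ = Σ_k χ(k) log sin(π·val k / N)` (the `log 2` is absorbed by `Σ χ = 0`).
[cite: Lang1990, Ch. 3 §2 Thm. 2.2 Case 1 (PDF p. 64)] -/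
theorem cyclotomicLogSum_eq_sum_log_sin (h1 : χ ≠ 1) :
    cyclotomicLogSum χ = ∑ k : ZMod N, χ k * (Real.log (Real.sin (Real.pi * k.val / N)) : ℂ) := by
  have hsum : ∑ k : ZMod N, χ k = 0 := MulChar.sum_eq_zero_of_ne_one h1
  have h0 : χ 0 = 0 := χ.map_zero' (level_ne_one h1)
  rw [cyclotomicLogSum, sum_units_eq_sum_mul χ (fun x => (Real.log ‖1 - rootOfUnityPow x‖ : ℂ))]
  -- termwise: `χ k · log|1 − ζ^k| = χ k · (log 2 + log sin)` (at `k = 0` both sides vanish)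
  have hterm : ∀ k : ZMod N, χ k * (Real.log ‖1 - rootOfUnityPow k‖ : ℂ) =
      χ k * (Real.log 2 : ℂ) + χ k * (Real.log (Real.sin (Real.pi * k.val / N)) : ℂ) := by
    intro k
    by_cases hk : k = 0
    · rw [hk, h0]; ring
    · have hN : (0 : ℝ) < N := by exact_mod_cast NeZero.pos N
      have hk0 : 0 < (k.val : ℝ) := by exact_mod_cast Nat.pos_of_ne_zero ((ZMod.val_ne_zero k).mpr hk)
      have hlt : (k.val : ℝ) < N := by exact_mod_cast ZMod.val_lt k
      have hx1 : (k.val : ℝ) / N < 1 := (div_lt_one hN).mpr hlt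
      have hsin : 0 < Real.sin (Real.pi * k.val / N) := by
        rw [mul_div_assoc]
        exact Real.sin_pos_of_pos_of_lt_pi (by positivity) (by nlinarith [Real.pi_pos])
      rw [rootOfUnityPow_eq_cexp_pow, norm_one_sub_cexp_pow (ZMod.val_lt k).le,
        Real.log_mul two_ne_zero hsin.ne', Complex.ofReal_add, mul_add]
  rw [Finset.sum_congr rfl fun k _ => hterm k, Finset.sum_add_distrib, ← Finset.sum_mul, hsum, zero_mul,
    zero_add]

end Sums

/-! ### The theorem -/

/-- ★ **`L'(0, χ) = −½ Σ_{a ∈ (ℤ/N)ˣ} χ(a) log|1 − ζ_N^a|`** for an EVEN Dirichlet character `χ ≠ 1` modulo `N`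
(`ζ_N = e^{2πi/N}`; the right-hand side is `−½ · cyclotomicLogSum χ`).  The `s = 0` companion of Lang's Thm 2.2;
from Lerch's formula and Euler's reflection formula. [cite: Lang1990, Ch. 3 §2 Thm. 2.2 (PDF pp. 63–64)] [folklore] -/
theorem deriv_LFunction_zero_eq_neg_half_cyclotomicLogSum {χ : DirichletCharacter ℂ N} (heven : χ.Even)
    (h1 : χ ≠ 1) : deriv χ.LFunction 0 = -(1 / 2) * cyclotomicLogSum χ := by
  rw [Lerch.deriv_LFunction_zero_of_ne_one h1, LFunction_zero_eq_zero heven h1, mul_zero, zero_add,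
    sum_range_log_Gamma_eq χ, sum_log_Gamma_eq_neg_half_sum_log_sin heven h1, cyclotomicLogSum_eq_sum_log_sin h1]

/-- The same with the sum written over all residues `k mod N` and `ζ_N^k = (e^{2πi/N})^{val k}`.
[cite: Lang1990, Ch. 3 §2 Thm. 2.2 (PDF pp. 63–64)] [folklore] -/
theorem deriv_LFunction_zero_eq_neg_half_sum_log_norm {χ : DirichletCharacter ℂ N} (heven : χ.Even)
    (h1 : χ ≠ 1) :
    deriv χ.LFunction 0 =
      -(1 / 2) * ∑ k : ZMod N, χ k * (Real.log ‖1 - cexp (2 * Real.pi * I / N) ^ k.val‖ : ℂ) := by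
  rw [deriv_LFunction_zero_eq_neg_half_cyclotomicLogSum heven h1, cyclotomicLogSum,
    sum_units_eq_sum_mul χ (fun x => (Real.log ‖1 - rootOfUnityPow x‖ : ℂ))]
  congr 1
  refine Finset.sum_congr rfl fun k _ => ?_
  rw [rootOfUnityPow_eq_cexp_pow]

/-- The log-sine form: `L'(0, χ) = −½ Σ_k χ(k) log sin(π·val k / N)`.
[cite: Lang1990, Ch. 3 §2 Thm. 2.2 Case 1 (PDF p. 64)] [folklore] -/
theorem deriv_LFunction_zero_eq_neg_half_sum_log_sin {χ : DirichletCharacter ℂ N} (heven : χ.Even)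
    (h1 : χ ≠ 1) :
    deriv χ.LFunction 0 = -(1 / 2) * ∑ k : ZMod N, χ k * (Real.log (Real.sin (Real.pi * k.val / N)) : ℂ) := by
  rw [deriv_LFunction_zero_eq_neg_half_cyclotomicLogSum heven h1, cyclotomicLogSum_eq_sum_log_sin h1]

/-- **With Lang's Thm 2.2** (`χ` even, PRIMITIVE of conductor `N > 2`): `L'(0, χ̄) = (N / (2·S(χ))) · L(1, χ)`, i.e.
`L(1, χ) = (2 S(χ)/N) · L'(0, χ̄)` — the two closed forms share the regulator sum `Σ χ̄(b) log|1 − ζ^b|`.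
[cite: Lang1990, Ch. 3 §2 Thm. 2.2 (PDF pp. 63–64)] -/
theorem deriv_LFunction_inv_zero_eq_of_primitive (hN : 2 < N) {χ : DirichletCharacter ℂ N} (hχ : χ.IsPrimitive)
    (heven : χ.Even) (hS : CyclotomicUnits.langGaussSum χ ≠ 0) :
    deriv χ⁻¹.LFunction 0 = (N / (2 * CyclotomicUnits.langGaussSum χ)) * χ.LFunction 1 := by
  have h1' : χ⁻¹ ≠ 1 := by
    intro h
    have hχ1 : χ = 1 := inv_eq_one.mp h
    rw [hχ1, DirichletCharacter.isPrimitive_def, DirichletCharacter.conductor_one] at hχ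
    omega
  have heven' : χ⁻¹.Even := by
    rw [DirichletCharacter.Even, MulChar.inv_apply_eq_inv', heven, inv_one]
  have hNC : (N : ℂ) ≠ 0 := by exact_mod_cast NeZero.ne N
  rw [deriv_LFunction_zero_eq_neg_half_cyclotomicLogSum heven' h1',
    CyclotomicUnits.cyclotomicLogSum_inv_eq CyclotomicUnits.lang_thm22_LFunction_one_of_even_holds hN χ hχ heven hS]
  field_simp

end DirichletLEvenAtZero

end Literature.NumberTheory.LFunctions

end
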